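import Mathlib
import HarnessLib
import Summits.QuantumAdvantage.QuantumAdvantage.Theses.PolyFeatureDial
import Summits.QuantumAdvantage.AdviceFreeQNC0.FeatOfVPE
import Summits.QuantumAdvantage.AdviceFreeQNC0.BlockParityChar
import Literature.Computability.MetaComplexity.SmolenskyCorrelationRestrict
import Literature.Computability.MetaComplexity.LowDegreeComposition
import Literature.Computability.MetaComplexity.ModqImmunity
import Literature.Computability.MetaComplexity.HypercubeSchwartzZippel
import Literature.Probability.Moments.HoeffdingCounting
import Literature.Computability.MetaComplexity.TwoModuliExpSums
import Literature.Computability.MetaComplexity.LowDegreeTwoModuliExpSums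
import Summits.QuantumAdvantage.QuantumAdvantage.Theorems.ParityPinning

set_option linter.dupNamespace false

/-!
# PurityDialLaw — the GAME-FREE law side of the lens-4 g6 node «PurityDial» (tree-ready twin)

DECOMPOSITION CELL decomp-qadv, lens 4 («minimal-counterexample / extremal reduction»), generation 6.
Companion of the node file `decomp-qadv-lens-4/g6/PurityDial.lean` (which also carries the game-side glue
through `PolyFeatureDial.closes`); this file imports ONLY the tree (the born route `Theses.PolyFeatureDial` for the
by-name records against item 29180 `RelSmolOdd`, `AdviceFreeQNC0.FeatOfVPE` for `HasDegF`, Literature) and is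
independent of the pending landings of `Theorems/PairFreezing` (g4) and the ParityPinning port (g5).

## Contents (all PROVED, 0 sorry; axioms `propext · Classical.choice · Quot.sound`)

* §0  ported g5 support (literal maps, `hasDegF_comp_literal`, the pairing involution); NO proposition is
      (re)defined here — item 29180 is referenced BY NAME as `Theses.PolyFeatureDial.RelSmolOdd`
      (`relSmolOdd_iff_law : … ↔ ∀ p ≥ 5, RelSmolLaw p 3 2 := Iff.rfl`), and the helper notions
      `RelBal R`, `LawAt p R`, `RelSmolLaw p R`, `WtDetermined`, `IsLiteralMap` are SET-valued (sets of
      functions / thresholds / exponents), so the file defines no `Prop`.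
* §14 THE PURITY DIAL `LawAt p R τ` / `RelSmolLaw p R B`: threshold normal form (`lawAt_iff_threshold`), purity end
      (`eq_false_of_pure`, `purity_sharp`, `not_lawAt_two_mul`: `τ(d) = 2d` FALSE for every `R`), exponential end
      (`lawAt_exp`: `τ(d) = (d+1)²4^{d+1}` TRUE at `R = 3`).
* §15 the dialed residual `RelSmolPolyOdd` (`∃ B`, stated INLINE), `relSmolPolyOdd_of_tree` (⇐ item 29180), and the law-level
      NORMAL FORM of a minimal counterexample `normalForm_of_not_relSmolPoly`.
* §16 THE FLOOR: `B = 1` is FALSE for every ratio (`not_relSmolLaw_one`, `two_le_of_relSmolLaw`; extremal family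
      `χ_{p^j} = [p^j ∣ |z|]`, `hasDegF_modqFn`, `modqFn_unbalanced`); `relSmolOdd_strongest`: item 29180 (`B = 2`) is
      the strongest live member.
* §17 THE EXTREMISER CLASS OBEYS `B = 2`: `q`-periodic symmetric functions are `3`-balanced on
      `m ≥ 2q²(log₂ q + 3)` bits (`relBal_three_symFn`), have degree `≤ q − 1` for `q = p^j` (`hasDegF_symFn`).
* §18 INTRINSIC ASYMMETRY: weight-determined + degree `< p^j` ⟹ `p^j`-periodic (`symFn_of_wtDetermined`), hence
      `relBal_three_of_wtDetermined` and the normal form `normalForm_not_wtDetermined_law`.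
* §19 LOCAL THINNESS ⇒ BALANCE (no dimension threshold): fibrewise cancellation mod `p` on any block of `k > d`
      coordinates (`fibrePart_modEq`, `fibrePart_eq_of_thin`, `parts_sub_le_heavy`, `relBal_three_of_thin[_perm]`),
      SMALL DEGREE EXACT (`parts_eq_of_pow_lt`: `p > 2^{k-1} ⇒ #odd = #even`), and the sharpened normal form
      `normalForm_thick_law` (a minimal counterexample has `2^d ≥ p` and is LOCALLY THICK in every `(d+1)`-block).
* §20 TENSOR CLOSURE OBEYS `B = 4`: conjunctions on disjoint blocks multiply relative bias
      (`card_oddPart_tensor`, `relBal_tensor_left/right`), factors inherit the degree bound (`hasDegF_tensor_left/right`),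
      a literal copy of `AND_t` certifies degree `≥ t` (`le_of_andCert`, via `altSum_eq_zero`), and the invariant
      `BlockInv` (weight-determined base `blockInv_of_wtDetermined`, closed under `tensor` and `permFn`) yields
      `relSmolLaw_four_of_blockInv`: the law with `A = 2p²(p+3)+1`, `B = 4` on the whole block-product class (closed also under
      input negation `blockInv_negFn`, small juntas `blockInv_of_small`); DISJUNCTIONS ARE FREE: `relBal_three_bor` — `bor g h`
      over a non-trivial split is ALWAYS `3`-balanced, for arbitrary `g`, `h`; DENSE IS EASY: `relBal_three_of_dense` (density
      `≥ 2^{-k}` on `m ≥ (d+1)²4^{k+1}` bits ⇒ `3`-balanced); normal forms `normalForm_not_blockInv_law`, `normalForm_sparse_law`;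
      CELL FORM `relBal_of_fibres` / `cell_mono` / `lawAt_iff_cells` / `relSmolLaw_iff_cells` / **`relSmolOdd_iff_cells`** (item 29180
      ⟺ for every prime `p ≥ 5`, `∃ A, ∀ d`, every degree-`≤ d` function on EXACTLY `A(d+1)²` bits is `3`-balanced; a certified
      census cell `(p,d,m₀)` holds for all `m ≥ m₀`); LINEAR FORMS `relBal_three_ofForms` / `relSmolLaw_one_ofForms` /
      `normalForm_highRank_law`: functions of `K` linear forms `mod p` (sparse, asymmetric) are `3`-balanced on
      `m ≥ 2p²(d+1+K(log₂p+1))` bits — `B = 1` on the class; a minimal counterexample has high `𝔽_p`-rank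
      (`normalForm_highPolyRank_law`, v11: and high POLYNOMIAL rank at every bounded degree modulo any odd `q`);
      `relBal_three_ofForms_mod` (any odd modulus); BLOCK WEIGHTS `blockWtClass` / `ofForms_of_blockWt` /
      `relBal_three_of_blockWt'` / record `relSmolOdd_blockWt_witness`: functions of `K` block weights with an ARBITRARY
      combiner are `3`-balanced past `2(p·max d 1)²(d+1+K(log₂(p·max d 1)+1))`; POLYNOMIAL TESTS `ofTests` /
      `abs_sub_parts_ofTests_le` / `relBal_three_ofTests`: functions of `K` polynomial tests of degree `≤ e` modulo ANY odd
      `q` (Green–Roy–Straubing / Bourgain, tree file `LowDegreeTwoModuliExpSums`) are `3`-balanced past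
      `2q²(q·2^q)^{e−1}(d+1+K(log₂q+1))` — linear in `d` and `K`; `hasDegF_ofTests` / `relBal_three_ofTests_self`: every
      Boolean combination of `K` degree-`e` tests over `𝔽_p` is `3`-balanced past `2p²(p·2^p)^{e−1}(Ke(p−1)+1+K(log₂p+1))`,
      unconditionally).
* §21 RECORDS for the tree item 29180: `relSmolOdd_symmetric_witness` — the law HOLDS on the symmetric class at a
      quadratic·log threshold (a BC5-type first rung of 29180 outside any regime where the blocker 28532 is known),
      `relSmolOdd_thin_witness`, `relSmolOdd_smallDegree_witness`, `relSmolOdd_blockProduct_witness` (block products,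
      `B = 4`), `relSmolOdd_disjunction_witness` (degree-free), `relSmolOdd_dense_witness` (density `≥ 2^{-k}` ⇒ `B = 2`
      at `m ≥ (d+1)²4^{k+1}`), `relSmolOdd_linearForms_witness` (functions of `K` linear forms `mod p`: threshold
      `2p²(d+1+K(log₂p+1))`, LINEAR in `d`), `relSmolOdd_blockWt_witness` (block-weight functions, any combiner:
      threshold `2(p·max d 1)²(d+1+K(log₂(p·max d 1)+1))`), `relSmolOdd_polyTests_witness` (functions of `K` degree-`e`
      polynomial tests modulo any odd `q`), `relSmolOdd_polyTests_self_witness` (tests over `𝔽_p`: NO degree hypothesis),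
      and `relSmolOdd_linear_variant_false` — its linear-threshold variant is theorem-false.

No `sorry`; no `set_option allowUnsafeReducibility`; no instances / notation; imports = tree only.
-/

noncomputable section

namespace Summit.QuantumAdvantage.QuantumAdvantage.Theorems.PurityDialLaw

open Classical Finset Summit.QuantumAdvantage.AdviceFreeQNC0
open Literature.Computability.MetaComplexity Literature.Computability.MetaComplexity.Smolensky
open Literature.Computability.Complexity (parityFn)

/-! ### §0 Ported from the g5 node ParityPinning (§10/§12/§13; bodies verbatim) -/
section Ported
variable {n : ℕ}

/-- Purity-dial helper `IsLiteralMap` (lens-4 g6 PurityDialLaw v12 twin; see the enclosing section docstring). -/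
def IsLiteralMap {m n : ℕ} : Set ((Fin m → Bool) → (Fin n → Bool)) := fun E =>
  ∀ j : Fin n, ∃ b : Bool, (∀ z, E z j = b) ∨ ∃ k : Fin m, ∀ z, E z j = xor b (z k)

/-- Purity-dial helper `hasDegF_comp_literal` (lens-4 g6 PurityDialLaw v12 twin; see the enclosing section docstring). -/
theorem hasDegF_comp_literal {p : ℕ} [Fact p.Prime] {m d : ℕ} {g : (Fin n → Bool) → Bool} (hg : HasDegF p g d)
    {E : (Fin m → Bool) → (Fin n → Bool)} (hE : IsLiteralMap E) : HasDegF p (fun z => g (E z)) d := by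
  have hcoord : ∀ j : Fin n,
      (fun z : Fin m → Bool => if E z j = true then (1 : ZMod p) else 0) ∈ lowDeg (ZMod p) m 1 := by
    intro j
    obtain ⟨b, hb⟩ := hE j
    rcases hb with hconst | ⟨k, hk⟩
    · cases b
      · have : (fun z : Fin m → Bool => if E z j = true then (1 : ZMod p) else 0) = 0 := by
          funext z; rw [hconst z]; simp
        rw [this]; exact (lowDeg (ZMod p) m 1).zero_mem
      · have : (fun z : Fin m → Bool => if E z j = true then (1 : ZMod p) else 0) = 1 := by
          funext z; rw [hconst z]; simp
        rw [this]; exact one_mem_lowDeg 1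
    · have hmono : mono (ZMod p) ({k} : Finset (Fin m)) = fun z => if z k = true then (1 : ZMod p) else 0 := by
        funext z; unfold mono; rw [prod_singleton]
      cases b
      · have : (fun z : Fin m → Bool => if E z j = true then (1 : ZMod p) else 0) = mono (ZMod p) {k} := by
          rw [hmono]; funext z; rw [hk z, Bool.false_xor]
        rw [this]
        exact mono_mem_lowDeg (by rw [card_singleton])
      · have : (fun z : Fin m → Bool => if E z j = true then (1 : ZMod p) else 0) = 1 - mono (ZMod p) {k} := by
          rw [hmono]; funext z; rw [hk z, Bool.true_xor]
          simp only [Pi.sub_apply, Pi.one_apply]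
          cases z k <;> simp
        rw [this]
        exact (lowDeg (ZMod p) m 1).sub_mem (one_mem_lowDeg 1) (mono_mem_lowDeg (by rw [card_singleton]))
  exact Smolensky.comp_mem_lowDeg_of_coord E hcoord hg


end Ported

/-! ### §14 THE PURITY DIAL (game-free law side): ratio `R`, threshold `τ`, both ends theorems -/

section Dial

variable {m : ℕ}

/-- the odd-parity part of the level set `{f = true}`. -/
def oddPart (f : (Fin m → Bool) → Bool) : Finset (Fin m → Bool) :=
  univ.filter fun z => f z = true ∧ parityFn m z = true

/-- the even-parity part of the level set `{f = true}`. -/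
def evenPart (f : (Fin m → Bool) → Bool) : Finset (Fin m → Bool) :=
  univ.filter fun z => f z = true ∧ parityFn m z = false

/-- **`RelBal R f`** — the level set of `f` is PARITY-BALANCED IN RATIO `R`: its odd and even parts are within a
factor `R` of each other (relative parity bias `≤ (R−1)/(R+1)`).  `R = 3` is g5's `Balanced`/`RelSmolensky` ratio;
`R → ∞` is NEAR-PURITY-freeness; exact purity (one part empty, the other not) violates every `R`. -/
def RelBal (R : ℕ) : Set ((Fin m → Bool) → Bool) := fun f =>
  (oddPart f).card ≤ R * (evenPart f).card ∧ (evenPart f).card ≤ R * (oddPart f).card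

/-- **`LawAt p R τ`** — THE DIAL: every Boolean function of `𝔽_p`-degree `≤ d` on `m ≥ τ d` bits is `R`-balanced. -/
def LawAt (p : ℕ) [Fact p.Prime] (R : ℕ) : Set (ℕ → ℕ) := fun τ =>
  ∀ m d : ℕ, τ d ≤ m → ∀ f : (Fin m → Bool) → Bool, HasDegF p f d → RelBal R f

/-- **`RelSmolLaw p R B`** — the POLYNOMIAL-THRESHOLD members of the dial: `τ d = A·(d+1)^B` for some `A`. -/
def RelSmolLaw (p : ℕ) [Fact p.Prime] (R : ℕ) : Set ℕ := fun B => ∃ A : ℕ, LawAt p R (fun d => A * (d + 1) ^ B)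

/-- record (BY-NAME junction): the tree's item 29180 `Theses.PolyFeatureDial.RelSmolOdd` is the dial member
`(R, B) = (3, 2)` at every prime `p ≥ 5`, definitionally. -/
theorem relSmolOdd_iff_law :
    Theses.PolyFeatureDial.RelSmolOdd ↔ ∀ (p : ℕ) [Fact p.Prime], 5 ≤ p → RelSmolLaw p 3 2 := Iff.rfl

/-- monotonicity in the ratio. -/
theorem relBal_mono {R R' : ℕ} (h : R ≤ R') {f : (Fin m → Bool) → Bool} (hf : RelBal R f) : RelBal R' f :=
  ⟨hf.1.trans (Nat.mul_le_mul_right _ h), hf.2.trans (Nat.mul_le_mul_right _ h)⟩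

/-- the dial is monotone: larger ratio and larger threshold are weaker laws. -/
theorem lawAt_mono {p : ℕ} [Fact p.Prime] {R R' : ℕ} {τ τ' : ℕ → ℕ} (hR : R ≤ R') (hτ : ∀ d, τ d ≤ τ' d)
    (h : LawAt p R τ) : LawAt p R' τ' :=
  fun m d hm f hf => relBal_mono hR (h m d ((hτ d).trans hm) f hf)

/-- … in particular along the polynomial family. -/
theorem relSmolLaw_mono {p : ℕ} [Fact p.Prime] {R R' B B' : ℕ} (hR : R ≤ R') (hB : B ≤ B')
    (h : RelSmolLaw p R B) : RelSmolLaw p R' B' := by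
  obtain ⟨A, hA⟩ := h
  exact ⟨A, lawAt_mono hR (fun d => Nat.mul_le_mul_left _ (Nat.pow_le_pow_right (Nat.succ_pos d) hB)) hA⟩

/-! #### (a) dimension monotonicity: the law IS its instance at the threshold dimension -/

/-- parity of a one-bit extension. -/
theorem parityFn_cons (b : Bool) (z : Fin m → Bool) :
    parityFn (m + 1) (Fin.cons b z : Fin (m + 1) → Bool) = xor b (parityFn m z) := by
  unfold parityFn Literature.Computability.Complexity.GateFn.numOnes
  rw [Finset.card_filter, Finset.card_filter, Fin.sum_univ_succ]
  simp only [Fin.cons_zero, Fin.cons_succ]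
  set N := ∑ i : Fin m, (if z i = true then 1 else 0) with hN
  cases b
  · simp
  · simp only [if_true, Bool.true_xor]
    rcases Nat.mod_two_eq_zero_or_one N with h | h
    · have h' : (1 + N) % 2 = 1 := by omega
      rw [h', h]; decide
    · have h' : (1 + N) % 2 = 0 := by omega
      rw [h', h]; decide

/-- counting over `{0,1}^{m+1}` by the first bit. -/
theorem card_filter_succ (P : (Fin (m + 1) → Bool) → Prop) [DecidablePred P] :
    (univ.filter P).card =
      (univ.filter fun z : Fin m → Bool => P (Fin.cons true z)).card +
      (univ.filter fun z : Fin m → Bool => P (Fin.cons false z)).card := by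
  rw [Finset.card_filter, Finset.card_filter, Finset.card_filter,
    ← (Fin.consEquiv fun _ : Fin (m + 1) => Bool).sum_comp (fun x => if P x then 1 else 0),
    Fintype.sum_prod_type, Fintype.sum_bool]
  rfl

/-- the one-bit extension along the first coordinate is a literal map. -/
theorem isLiteralMap_cons (b : Bool) :
    IsLiteralMap (fun z : Fin m → Bool => (Fin.cons b z : Fin (m + 1) → Bool)) := by
  intro j
  refine Fin.cases ?_ (fun k => ?_) j
  · exact ⟨b, Or.inl fun z => by simp⟩
  · exact ⟨false, Or.inr ⟨k, fun z => by simp⟩⟩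

/-- slices of a degree-`d` function have degree `≤ d`. -/
theorem hasDegF_cons {p : ℕ} [Fact p.Prime] {d : ℕ} {f : (Fin (m + 1) → Bool) → Bool} (hf : HasDegF p f d)
    (b : Bool) : HasDegF p (fun z : Fin m → Bool => f (Fin.cons b z)) d :=
  hasDegF_comp_literal hf (isLiteralMap_cons b)

/-- **both slices `R`-balanced ⇒ `R`-balanced** (`#odd(f) = #even(f₁) + #odd(f₀)`, `#even(f) = #odd(f₁) + #even(f₀)`). -/
theorem relBal_of_slices {R : ℕ} (f : (Fin (m + 1) → Bool) → Bool)
    (h : ∀ b : Bool, RelBal R (fun z : Fin m → Bool => f (Fin.cons b z))) : RelBal R f := by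
  have hodd : (oddPart f).card =
      (evenPart fun z : Fin m → Bool => f (Fin.cons true z)).card
        + (oddPart fun z : Fin m → Bool => f (Fin.cons false z)).card := by
    unfold oddPart evenPart
    rw [card_filter_succ]
    congr 1 <;> refine congrArg Finset.card (Finset.filter_congr fun z _ => ?_) <;> rw [parityFn_cons] <;>
      cases parityFn m z <;> simp
  have heven : (evenPart f).card =
      (oddPart fun z : Fin m → Bool => f (Fin.cons true z)).card
        + (evenPart fun z : Fin m → Bool => f (Fin.cons false z)).card := by
    unfold oddPart evenPart
    rw [card_filter_succ]
    congr 1 <;> refine congrArg Finset.card (Finset.filter_congr fun z _ => ?_) <;> rw [parityFn_cons] <;>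
      cases parityFn m z <;> simp
  obtain ⟨h1t, h2t⟩ := h true
  obtain ⟨h1f, h2f⟩ := h false
  refine ⟨?_, ?_⟩
  · rw [hodd, heven, Nat.mul_add]; exact Nat.add_le_add h2t h1f
  · rw [hodd, heven, Nat.mul_add]; exact Nat.add_le_add h1t h2f

/-- **THE THRESHOLD FORM** (extremal reduction on the law side, PROVED): the law at every dimension `m ≥ τ d` is
EQUIVALENT to the law at the single dimension `m = τ d` — a minimal counterexample lives exactly at the threshold. -/
theorem lawAt_iff_threshold {p : ℕ} [Fact p.Prime] {R : ℕ} {τ : ℕ → ℕ} :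
    LawAt p R τ ↔ ∀ d : ℕ, ∀ f : (Fin (τ d) → Bool) → Bool, HasDegF p f d → RelBal R f := by
  constructor
  · intro h d f hf
    exact h (τ d) d le_rfl f hf
  · intro h m d hm
    induction m, hm using Nat.le_induction with
    | base => exact h d
    | succ m hm ih =>
      intro f hf
      exact relBal_of_slices f fun b => ih _ (hasDegF_cons hf b)

/-- the polynomial family in threshold form. -/
theorem relSmolLaw_iff_threshold {p : ℕ} [Fact p.Prime] {R B : ℕ} :
    RelSmolLaw p R B ↔
      ∃ A : ℕ, ∀ d : ℕ, ∀ f : (Fin (A * (d + 1) ^ B) → Bool) → Bool, HasDegF p f d → RelBal R f :=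
  exists_congr fun _ => lawAt_iff_threshold

/-! #### (b) the `R = ∞` end: EXACT PURITY is impossible beyond `m = 2d` (Beck–Li immunity, in the tree) -/

/-- **PURITY THEOREM** (`R = ∞` endpoint of the dial, linear threshold; = Beck–Li 2013 Thm 3.4 with `q = 2`, the
tree's `Smolensky.beckLi2013_thm34`): for an odd prime `p`, a Boolean function of `𝔽_p`-degree `≤ d` on `m ≥ 2d+1`
bits whose level set lies inside ONE parity class is identically `false`. -/
theorem eq_false_of_pure {p : ℕ} [hp : Fact p.Prime] (hp2 : p ≠ 2) {d : ℕ} (hm : 2 * d < m)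
    {f : (Fin m → Bool) → Bool} (hf : HasDegF p f d) (b : Bool)
    (hpure : ∀ z, f z = true → parityFn m z = b) : f = fun _ => false := by
  have hpq : ¬ p ∣ 2 := fun h => hp2 ((Nat.prime_dvd_prime_iff_eq hp.out Nat.prime_two).1 h)
  have hsupp : ∀ z : Fin m → Bool, (fun x : Fin m → Bool => if f x = true then (1 : ZMod p) else 0) z ≠ 0 →
      (univ.filter fun i => z i = true).card % 2 = (if b = true then 1 else 0) % 2 := by
    intro z hz
    cases hfz : f z
    · exact absurd (by simp [hfz]) hz
    · have hpz := hpure z hfz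
      unfold parityFn Literature.Computability.Complexity.GateFn.numOnes at hpz
      cases b
      · have : ¬ (univ.filter fun i => z i = true).card % 2 = 1 := by simpa using hpz
        simp only [Bool.false_eq_true, if_false, Nat.zero_mod]
        omega
      · have : (univ.filter fun i => z i = true).card % 2 = 1 := by simpa using hpz
        simpa using this
  have h0 := Smolensky.beckLi2013_thm34 (p := p) (n := m) (q := 2) (by norm_num) hpq hm hf
    (if b = true then 1 else 0) hsupp
  funext z
  have hz := congrFun h0 z
  simp only [Pi.zero_apply] at hz
  cases hfz : f z
  · rfl
  · rw [hfz, if_pos rfl] at hz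
    exact absurd hz one_ne_zero

/-- hence a counterexample to ANY member of the dial beyond `m = 2d` is MIXED: both parity parts are non-empty
(near-pure, never pure). -/
theorem parts_nonempty_of_not_relBal {p : ℕ} [Fact p.Prime] (hp2 : p ≠ 2) {R d : ℕ} (hm : 2 * d < m)
    {f : (Fin m → Bool) → Bool} (hf : HasDegF p f d) (h : ¬ RelBal R f) :
    (oddPart f).Nonempty ∧ (evenPart f).Nonempty := by
  by_contra hne
  apply h
  have hcase : oddPart f = ∅ ∨ evenPart f = ∅ := by
    rcases not_and_or.1 hne with h1 | h1
    · exact Or.inl (Finset.not_nonempty_iff_eq_empty.1 h1)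
    · exact Or.inr (Finset.not_nonempty_iff_eq_empty.1 h1)
  have hzero : f = fun _ => false := by
    rcases hcase with h0 | h0
    · refine eq_false_of_pure hp2 hm hf false fun z hz => ?_
      by_contra hpz
      have : z ∈ oddPart f := by
        rw [oddPart, mem_filter]; exact ⟨mem_univ _, hz, by simpa using hpz⟩
      rw [h0] at this; exact absurd this (Finset.notMem_empty _)
    · refine eq_false_of_pure hp2 hm hf true fun z hz => ?_
      by_contra hpz
      have : z ∈ evenPart f := by
        rw [evenPart, mem_filter]; exact ⟨mem_univ _, hz, by simpa using hpz⟩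
      rw [h0] at this; exact absurd this (Finset.notMem_empty _)
  have ho : oddPart f = ∅ := by
    rw [oddPart, Finset.filter_eq_empty_iff]; intro z _; rw [hzero]; simp
  have he : evenPart f = ∅ := by
    rw [evenPart, Finset.filter_eq_empty_iff]; intro z _; rw [hzero]; simp
  refine ⟨?_, ?_⟩ <;> rw [ho, he] <;> simp


end Dial
end Summit.QuantumAdvantage.QuantumAdvantage.Theorems.PurityDialLaw
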